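import Literature.Geometry.Riemannian.ShrinkerRicciBarrierPoint
import Literature.Geometry.Riemannian.ThreeShrinkerCompactReduction
import Literature.Geometry.Riemannian.BakryEmeryHeatFlow
import Literature.Geometry.Lorentzian.CoordOrthonormalEigenframe
import Literature.Geometry.Lorentzian.CoordRicciNonnegOfPinching
import Literature.Geometry.Lorentzian.CoordRayleighSup
import Literature.Geometry.Lorentzian.CoordLaplacianChainRule
import HarnessLib

/-!
# Step 1 of Munteanu–Wang's compactness theorem on a three-dimensional shrinker: the chart step

Second layer of step 1 ("`Ric ≥ c/f`") of O. Munteanu, J. Wang, *Positively curved shrinking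
Ricci solitons are compact*, J. Differential Geom. 106 (2017), Thm. 2 (B. Chow, *Ricci solitons in
low dimensions* (2023), Thm. 4.47), for three-dimensional gradient shrinkers `Ric + Hess f = ½ g`,
`R + |∇f|² = f`, with `sect ≥ 0` (`2 Ric ≤ R g`) and `Ric ≥ 0`. Let `Λ` be a lower bound of the
Ricci form (`Λ(y)|w|² ≤ Ric_y(w,w)`) which is the greatest such bound at a point `p`, let `gb` be a
smooth function of one variable and `a, m₀, ρ₀` constants with the regional pinching
`(a gb(f y) + m₀)|w|² ≤ Ric_y(w,w)` wherever `ρ₀ < f(y)`, and equality of the bounds at `p`: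
`ρ₀ < f(p)`, `Λ(p) = a gb(f p) + m₀` (a minimum point of `Λ − a gb(f)` on `{f > ρ₀}`). Then

* **`MunteanuWang.chart_step`** —
  `a (gb'(f p)(3/2 − f p) + gb''(f p)(f p − R p)) ≤ Λ(p)`,
  i.e. `Δ_f (a gb ∘ f)(p) ≤ λ_min(p)`: read in the chart at `p` this is
  `IsMetricOn.weightedLaplacian_le_at_ricci_pinching_minimum` (bottom eigenframe, the chain rule
  `lapAt_comp`, `Δf = 3/2 − R`, `|∇f|² = f − R`).
* **`MunteanuWang.exists_pos_le_ricci`** — `Ric > 0` at a point gives a constant `c > 0` with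
  `c|w|² ≤ Ric(w,w)` there (compactness of the unit sphere, read in a chart).

Everything is proved; no definition is introduced.

## References

* O. Munteanu, J. Wang, J. Differential Geom. 106 (2017) = arXiv:1504.07898, Thm. 2, proof. [MunteanuWang2017]
* B.-L. Chow, P. Lu, B. Yang, C. R. Math. 349 (2011) (the barrier `a f⁻¹ + na f⁻²`). [MunteanuWang2017]
-/

noncomputable section

set_option maxSynthPendingDepth 3

open Set Filter Module Metric
open scoped Manifold ContDiff Topology

namespace Literature.Geometry.Riemannian

open Lorentzian Lorentzian.PseudoRiemannianMetric

variable {E : Type*} [NormedAddCommGroup E] [NormedSpace ℝ E] [FiniteDimensional ℝ E]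
  {H : Type*} [TopologicalSpace H] {I : ModelWithCorners ℝ E H} [I.Boundaryless]
  {M : Type*} [TopologicalSpace M] [ChartedSpace H M] [IsManifold I ∞ M]
  (g : PseudoRiemannianMetric I ∞ E (TangentSpace I : M → Type _)) [g.HasLeviCivita]

namespace MunteanuWang

/-- **A positive lower bound of the Ricci form at a point where `Ric > 0`**: if `Ric_p(w,w) > 0`
for all `w ≠ 0` then `c |w|² ≤ Ric_p(w,w)` for some `c > 0` (the bottom of the Rayleigh quotient
over the compact unit sphere, read in a chart: `MetricCoord.exists_rayleighSup_eq` for `−Ric`).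
[folklore] -/
theorem exists_pos_le_ricci [Nontrivial E] (hg : g.IsRiemannian) (p : M)
    (hpos : ∀ w : TangentSpace I p, w ≠ 0 → 0 < g.ricci p w w) :
    ∃ c : ℝ, 0 < c ∧ ∀ w : TangentSpace I p, c * g.val p w w ≤ g.ricci p w w := by
  -- chart at `p`
  set G := chartRep I (fun _ ↦ g) p 0 with hGdef
  have hu₀ : extChartAt I p p ∈ (extChartAt I p).target := mem_extChartAt_target p
  set u₀ : chartTarget I p := ⟨extChartAt I p p, hu₀⟩ with hu₀def
  have hpu : chartInv I p u₀ = p := extChartAt_to_inv p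
  have hposG : ∀ v : E, v ≠ 0 → 0 < G u₀ v v := fun v hv ↦ by
    rw [hGdef, chartRep_apply]
    exact chartPullback_pos g p u₀ (fun w' hw' ↦ hg _ w' hw') v hv
  -- the top of the Rayleigh quotient of `−Ric` is attained
  obtain ⟨v, hv, hveq, hvle⟩ := MetricCoord.exists_rayleighSup_eq
    (B := fun y ↦ -MetricCoord.ricAt G y) (G := G) (y := (u₀ : E)) hposG
  set s := sSup ((fun w : E ↦ (-MetricCoord.ricAt G u₀) w w / G u₀ w w) '' {w | w ≠ 0}) with hs
  -- `c := −s = Ric(v,v)/|v|² > 0`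
  have hinj := injective_mfderiv_chartInv (I := I) p u₀
  set L := mfderiv 𝓘(ℝ, E) I (chartInv I p) u₀ with hL
  have hLv : L v ≠ 0 := fun h0 ↦ hv (hinj (h0.trans (map_zero _).symm))
  have hricv : MetricCoord.ricAt G u₀ v v = g.ricci (chartInv I p u₀) (L v) (L v) :=
    (ricci_chartInv_mfderiv_eq_ricAt g p u₀ v v).symm
  have hvalv : G u₀ v v = g.val (chartInv I p u₀) (L v) (L v) :=
    (val_chartInv_mfderiv_eq_chartRep g p u₀ v v).symm
  have hposQ : (fun y : M ↦ ∀ w : TangentSpace I y, w ≠ 0 → 0 < g.ricci y w w)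
      (chartInv I p u₀) := by
    rw [hpu]; exact hpos
  have hnegap : ∀ w : E, (-MetricCoord.ricAt G u₀) w w = -(MetricCoord.ricAt G u₀ w w) :=
    fun w ↦ rfl
  have hcpos : 0 < -s := by
    rw [← hveq, hnegap, neg_div, neg_neg]
    have h1 : 0 < MetricCoord.ricAt G u₀ v v := by
      rw [hricv]
      exact hposQ (L v) hLv
    exact div_pos h1 (hposG v hv)
  refine ⟨-s, hcpos, ?_⟩
  -- transport `−Ric(ŵ,ŵ) ≤ s G(ŵ,ŵ)` to the tangent space at `p`
  have hQ : (fun y : M ↦ ∀ w : TangentSpace I y, -s * g.val y w w ≤ g.ricci y w w)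
      (chartInv I p u₀) := by
    intro w
    have hinv := isInvertible_mfderiv_of_injective rfl hinj
    obtain ⟨v', hv'⟩ : ∃ v' : E, L v' = w :=
      ⟨L.inverse w, by rw [← ContinuousLinearMap.comp_apply, hinv.self_comp_inverse]; rfl⟩
    have h1 := hvle v'
    rw [hnegap] at h1
    rw [← hv', ricci_chartInv_mfderiv_eq_ricAt, val_chartInv_mfderiv_eq_chartRep]
    linarith
  rw [hpu] at hQ
  exact hQ

/-- **The chart step of Munteanu–Wang's step 1** (see the module docstring): at a minimum point
`p` of `Λ − a gb(f)` on `{f > ρ₀}` (`Λ` a lower bound of `Ric`, greatest at `p`, equal to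
`a gb(f p) + m₀` there, with the regional pinching `(a gb(f) + m₀)|·|² ≤ Ric` on `{f > ρ₀}`), on a
three-dimensional shrinker with `2 Ric ≤ R g` and `Ric ≥ 0`:
`a (gb'(f p)(3/2 − f p) + gb''(f p)(f p − R p)) ≤ Λ(p)`.
[cite: MunteanuWang2017, Thm. 2, proof, (2.3)–(2.7)] -/
theorem chart_step (hg : g.IsRiemannian) (h3 : finrank ℝ E = 3) {f : M → ℝ}
    (hf : ContMDiff I 𝓘(ℝ, ℝ) ∞ f)
    (hsol : ∀ (x : M) (X Y : TangentSpace I x),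
      g.ricci x X Y + g.hessian f x X Y = (1 / 2 : ℝ) * g.val x X Y)
    (hnorm : ∀ x : M, g.scalarCurvature x + g.gradSq f x = f x)
    (hRic0 : ∀ (x : M) (w : TangentSpace I x), 0 ≤ g.ricci x w w)
    (hsect : ∀ (x : M) (w : TangentSpace I x), 2 * g.ricci x w w ≤ g.scalarCurvature x * g.val x w w)
    (Λ : M → ℝ) (hΛ : ∀ (y : M) (w : TangentSpace I y), Λ y * g.val y w w ≤ g.ricci y w w)
    (p : M) (hΛp : ∀ c : ℝ, (∀ w : TangentSpace I p, c * g.val p w w ≤ g.ricci p w w) → c ≤ Λ p)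
    {gb : ℝ → ℝ} (hgbs : ContDiff ℝ ∞ gb) {a m₀ ρ₀ : ℝ}
    (hpin : ∀ y : M, ρ₀ < f y → ∀ w : TangentSpace I y,
      (a * gb (f y) + m₀) * g.val y w w ≤ g.ricci y w w)
    (hp : ρ₀ < f p) (heqΛ : Λ p = a * gb (f p) + m₀) :
    a * (deriv gb (f p) * (3 / 2 - f p) + deriv (deriv gb) (f p) * (f p - g.scalarCurvature p))
      ≤ Λ p := by
  classical
  -- ### chart data at `p`, restricted to `{f̂ > ρ₀}`
  set G := chartRep I (fun _ ↦ g) p 0 with hGdef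
  have hGm : MetricCoord.IsMetricOn G (extChartAt I p).target :=
    Lorentzian.OpensChart.isMetricOn_repr (val_chartPullback_eq_chartRep (fun _ : ℝ ↦ g) p 0)
  set fr : E → ℝ := f ∘ (extChartAt I p).symm with hfrdef
  have hfrep : ContDiffOn ℝ ∞ fr (extChartAt I p).target := by
    rw [hfrdef, ← contMDiffOn_iff_contDiffOn]
    exact hf.comp_contMDiffOn (contMDiffOn_extChartAt_symm p)
  set V : Set E := (extChartAt I p).target ∩ fr ⁻¹' Ioi ρ₀ with hVdef
  have hVopen : IsOpen V :=
    hfrep.continuousOn.isOpen_inter_preimage (isOpen_extChartAt_target p) isOpen_Ioi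
  have hVsub : V ⊆ (extChartAt I p).target := inter_subset_left
  have hGV : MetricCoord.IsMetricOn G V :=
    ⟨hVopen, hGm.contDiffOn.mono hVsub, fun x hx ↦ hGm.symm x (hVsub hx),
      fun x hx ↦ hGm.isInvertible x (hVsub hx)⟩
  have hu₀ : extChartAt I p p ∈ (extChartAt I p).target := mem_extChartAt_target p
  set u₀ : chartTarget I p := ⟨extChartAt I p p, hu₀⟩ with hu₀def
  have hpu : chartInv I p u₀ = p := extChartAt_to_inv p
  have hfru₀ : fr u₀ = f p := by
    show f ((extChartAt I p).symm (extChartAt I p p)) = f p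
    rw [extChartAt_to_inv]
  have hu₀V : (u₀ : E) ∈ V := ⟨hu₀, by show fr u₀ ∈ Ioi ρ₀; rw [hfru₀]; exact hp⟩
  have hpos : ∀ y ∈ (extChartAt I p).target, ∀ w : E, w ≠ 0 → 0 < G y w w := by
    intro y hy w hw
    rw [show y = ((⟨y, hy⟩ : chartTarget I p) : E) from rfl, hGdef, chartRep_apply]
    exact chartPullback_pos g p ⟨y, hy⟩ (fun w' hw' ↦ hg _ w' hw') w hw
  have hsolc : ∀ y ∈ V, ∀ v w : E,
      MetricCoord.ricAt G y v w + MetricCoord.hessAt G fr y v w = (1 / 2 : ℝ) * G y v w :=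
    fun y hy ↦ soliton_chartRep_target g p hf hsol y (hVsub hy)
  have hdict : ∀ (u : chartTarget I p) (v : E),
      G u v v = g.val (chartInv I p u) (mfderiv 𝓘(ℝ, E) I (chartInv I p) u v)
          (mfderiv 𝓘(ℝ, E) I (chartInv I p) u v) ∧
        MetricCoord.ricAt G u v v = g.ricci (chartInv I p u)
          (mfderiv 𝓘(ℝ, E) I (chartInv I p) u v) (mfderiv 𝓘(ℝ, E) I (chartInv I p) u v) ∧
        MetricCoord.scalAt G u = g.scalarCurvature (chartInv I p u) ∧
        fr u = f (chartInv I p u) := fun u v ↦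
    ⟨(val_chartInv_mfderiv_eq_chartRep g p u v v).symm,
      (ricci_chartInv_mfderiv_eq_ricAt g p u v v).symm,
      (Lorentzian.scalarCurvature_chartInv_eq g p u).symm, rfl⟩
  -- ### a bottom eigenframe of `Ric_p`
  have hs := hGm.symm _ hu₀
  have hi := hGm.isInvertible _ hu₀
  obtain ⟨e', μ', he', hμ'⟩ := MetricCoord.exists_orthonormal_eigenframe hs (hpos _ hu₀)
    (MetricCoord.ricAt G u₀) (fun v w ↦ hGm.ricAt_comm hu₀ v w)
  set e'' : Basis (Fin 3) ℝ E := e'.reindex (finCongr h3) with he''def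
  set μ'' : Fin 3 → ℝ := μ' ∘ (finCongr h3).symm with hμ''def
  have he''on : ∀ i j, G u₀ (e'' i) (e'' j) = if i = j then 1 else 0 := fun i j ↦ by
    rw [he''def, Basis.reindex_apply, Basis.reindex_apply, he']
    simp only [finCongr_symm, finCongr_apply, Fin.cast_inj]
  have hμ''ev : ∀ i w, MetricCoord.ricAt G u₀ (e'' i) w = μ'' i * G u₀ (e'' i) w := fun i w ↦ by
    rw [he''def, Basis.reindex_apply, hμ', hμ''def, Function.comp_apply]
  obtain ⟨j, -, hj⟩ := Finset.exists_min_image Finset.univ μ'' Finset.univ_nonempty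
  obtain ⟨σ, hσ0, -⟩ := exists_perm_fin_three j μ''
  set e : Basis (Fin 3) ℝ E := e''.reindex σ.symm with hedef
  set μ : Fin 3 → ℝ := μ'' ∘ σ with hμdef
  have hei : ∀ i, e i = e'' (σ i) := fun i ↦ by
    rw [hedef, Basis.reindex_apply, Equiv.symm_symm]
  have he : ∀ i k, G u₀ (e i) (e k) = if i = k then 1 else 0 := fun i k ↦ by
    rw [hei i, hei k, he''on]
    simp only [EmbeddingLike.apply_eq_iff_eq]
  have hμ : ∀ i w, MetricCoord.ricAt G u₀ (e i) w = μ i * G u₀ (e i) w := fun i w ↦ by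
    rw [hei i, hμ''ev, hμdef, Function.comp_apply]
  have hbot : ∀ i, μ 0 ≤ μ i := fun i ↦ by
    rw [hμdef, Function.comp_apply, Function.comp_apply, hσ0]
    exact hj _ (Finset.mem_univ _)
  have he00 : G u₀ (e 0) (e 0) = 1 := by rw [he]; simp
  have hSsum : MetricCoord.scalAt G u₀ = μ 0 + μ 1 + μ 2 := by
    rw [MetricCoord.scalAt_eq_sum_of_eigenframe e he hμ hi, Fin.sum_univ_three]
  -- `Λ p = μ₀`, `0 ≤ μ₀`, and the sectional inequalities `2μᵢ ≤ S`
  have hΛeq : Λ p = μ 0 := by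
    apply le_antisymm
    · have h1 := hΛ (chartInv I p u₀) (mfderiv 𝓘(ℝ, E) I (chartInv I p) u₀ (e 0))
      rw [← (hdict u₀ (e 0)).1, ← (hdict u₀ (e 0)).2.1, hμ, he00, mul_one, mul_one, hpu] at h1
      exact h1
    · have hQ : (fun x : M ↦ ∀ w : TangentSpace I x, μ 0 * g.val x w w ≤ g.ricci x w w)
          (chartInv I p u₀) := by
        intro w
        have hinj := injective_mfderiv_chartInv (I := I) p u₀
        have hinv := isInvertible_mfderiv_of_injective rfl hinj
        set L := mfderiv 𝓘(ℝ, E) I (chartInv I p) u₀ with hL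
        obtain ⟨v, hv⟩ : ∃ v : E, L v = w :=
          ⟨L.inverse w, by rw [← ContinuousLinearMap.comp_apply, hinv.self_comp_inverse]; rfl⟩
        have h1 := MetricCoord.mul_le_ricAt_of_le_eigenframe e he hμ
          (fun v w ↦ hGm.ricAt_comm hu₀ v w) hbot v
        rw [(hdict u₀ v).1, (hdict u₀ v).2.1] at h1
        rw [← hv]
        exact h1
      rw [hpu] at hQ
      exact hΛp (μ 0) hQ
  have hμi : ∀ i, 0 ≤ μ i ∧ 2 * μ i ≤ μ 0 + μ 1 + μ 2 := fun i ↦ by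
    have h1 := hRic0 (chartInv I p u₀) (mfderiv 𝓘(ℝ, E) I (chartInv I p) u₀ (e i))
    have h2 := hsect (chartInv I p u₀) (mfderiv 𝓘(ℝ, E) I (chartInv I p) u₀ (e i))
    rw [← (hdict u₀ (e i)).2.1, MetricCoord.ricAt_eigenframe_apply e he hμ] at h1 h2
    rw [← (hdict u₀ (e i)).1, ← (hdict u₀ (e i)).2.2.1, he, hSsum] at h2
    simp only [if_true, mul_one] at h1 h2
    constructor
    · exact h1
    · linarith
  -- ### the pinching function `Ψ = a gb ∘ f̂ + m₀` on `V`
  set gΨ : ℝ → ℝ := fun t ↦ a * gb t + m₀ with hgΨ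
  have hgΨs : ContDiff ℝ ∞ gΨ := (contDiff_const.mul hgbs).add contDiff_const
  set Ψ : E → ℝ := fun y ↦ gΨ (fr y) with hΨdef
  have hΨs : ContDiffOn ℝ ∞ Ψ V := hgΨs.comp_contDiffOn (hfrep.mono hVsub)
  have hpinV : ∀ y ∈ V, ∀ w : E, Ψ y * G y w w ≤ MetricCoord.ricAt G y w w := by
    intro y hy w
    set u : chartTarget I p := ⟨y, hVsub hy⟩ with hudef
    obtain ⟨hval, hric, -, hfz⟩ := hdict u w
    have hyu : (y : E) = (u : E) := rfl
    have hgt : ρ₀ < f (chartInv I p u) := by rw [← hfz]; exact hy.2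
    have h1 := hpin (chartInv I p u) hgt (mfderiv 𝓘(ℝ, E) I (chartInv I p) u w)
    rw [hyu, hval, hric]
    simpa only [hΨdef, hgΨ, hfz] using h1
  have heqV : MetricCoord.ricAt G u₀ (e 0) (e 0) = Ψ u₀ * G u₀ (e 0) (e 0) := by
    rw [MetricCoord.ricAt_eigenframe_apply e he hμ, he00]
    simp only [if_true, mul_one, hΨdef, hgΨ, hfru₀]
    rw [← heqΛ, hΛeq]
  -- ### the point inequality and its unfolding
  have hB := hGV.weightedLaplacian_le_at_ricci_pinching_minimum hu₀V (hpos _ hu₀)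
    (hfrep.mono hVsub) hsolc e he hμ hbot (hμi 0).1 (fun i ↦ (hμi i).2) hΨs hpinV heqV
  -- `lapAt Ψ` and `dΨ` by the chain rule
  have h2top : ((2 : ℕ∞) : ℕ∞ω) ≤ ∞ := WithTop.coe_le_coe.mpr le_top
  have hfr2 : ContDiffAt ℝ 2 fr u₀ :=
    (hfrep.contDiffAt ((isOpen_extChartAt_target p).mem_nhds hu₀)).of_le h2top
  have hgΨ2 : ContDiff ℝ 2 gΨ := hgΨs.of_le h2top
  have hlapΨ : MetricCoord.lapAt G Ψ u₀ = deriv gΨ (fr u₀) * MetricCoord.lapAt G fr u₀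
      + deriv (deriv gΨ) (fr u₀) * fderiv ℝ fr u₀ (MetricCoord.sharpAt G u₀ (fderiv ℝ fr u₀)) :=
    MetricCoord.lapAt_comp hgΨ2 hfr2
  have hdΨ : fderiv ℝ Ψ u₀ = deriv gΨ (fr u₀) • fderiv ℝ fr u₀ :=
    MetricCoord.fderiv_comp_eq hgΨ2 (hfr2.differentiableAt (by norm_num))
  -- derivatives of `gΨ`
  have hgbd : ∀ t, DifferentiableAt ℝ gb t := fun t ↦ (contDiff_infty_iff_deriv.1 hgbs).1 t
  have hgb's : ContDiff ℝ ∞ (deriv gb) := (contDiff_infty_iff_deriv.1 hgbs).2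
  have hgb'd : ∀ t, DifferentiableAt ℝ (deriv gb) t := fun t ↦
    (contDiff_infty_iff_deriv.1 hgb's).1 t
  have hd1 : ∀ t, deriv gΨ t = a * deriv gb t := fun t ↦ by
    rw [hgΨ]
    rw [deriv_add_const, deriv_const_mul _ (hgbd t)]
  have hd2 : deriv (deriv gΨ) (fr u₀) = a * deriv (deriv gb) (fr u₀) := by
    have : deriv gΨ = fun t ↦ a * deriv gb t := funext hd1
    rw [this, deriv_const_mul _ (hgb'd _)]
  -- `Δ f̂ = 3/2 − S`, `|∇f̂|² = f − S`
  have htrace : MetricCoord.scalAt G u₀ + MetricCoord.lapAt G fr u₀ = (1 / 2 : ℝ) * finrank ℝ E :=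
    MetricCoord.scalAt_add_lapAt_of_soliton hi (hsolc u₀ hu₀V)
  have hlapf : MetricCoord.lapAt G fr u₀ = 3 / 2 - g.scalarCurvature p := by
    rw [h3] at htrace
    rw [(hdict u₀ (e 0)).2.2.1, hpu] at htrace
    push_cast at htrace
    linarith
  have hfdiff : MDifferentiableAt I 𝓘(ℝ, ℝ) f (chartInv I p u₀) :=
    (hf.of_le (WithTop.coe_le_coe.mpr le_top) : ContMDiff I 𝓘(ℝ, ℝ) 1 f).mdifferentiableAt
      one_ne_zero
  have hgrad : fderiv ℝ fr u₀ (MetricCoord.sharpAt G u₀ (fderiv ℝ fr u₀)) =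
      f p - g.scalarCurvature p := by
    rw [← MetricCoord.gradSqAt_apply, hfrdef, hGdef, ← gradSq_chartInv_eq g p u₀ hfdiff, hpu]
    linarith [hnorm p]
  -- assemble
  have hLHS : MetricCoord.lapAt G Ψ u₀ - fderiv ℝ Ψ u₀ (MetricCoord.sharpAt G u₀ (fderiv ℝ fr u₀))
      = a * (deriv gb (f p) * (3 / 2 - f p)
        + deriv (deriv gb) (f p) * (f p - g.scalarCurvature p)) := by
    rw [hlapΨ, hdΨ]
    simp only [FunLike.coe_smul, Pi.smul_apply, smul_eq_mul]
    rw [hd2, hd1, hlapf, hgrad, hfru₀]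
    ring
  rw [hLHS, ← hΛeq] at hB
  exact hB

end MunteanuWang

end Literature.Geometry.Riemannian

end
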